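import Literature.NumberTheory.ComplexMultiplication.CMTypeSignatureGaloisClasses
import HarnessLib

/-!
# The reflex field of a CM type with the Harris–Taylor / Rapoport–Smithling–Zhang signature
# `((1, n−1)_{φ₀}, (0, n)_{ψ ∉ {φ₀, φ̄₀}})` over a subfield `k₀ ≤ K` of ANY degree: `σ₀(K) ⊆ K*` (`n ≥ 3`), and
# `K* = σ₀(K) ≅ K` as soon as `Aut(ℂ/φ₀(k₀))` fixes every embedding of `k₀` (e.g. `k₀/ℚ` normal)

Layer `Literature/NumberTheory/ComplexMultiplication`, namespace `Literature.NumberTheory.ComplexMultiplication` (lane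
`lit-hodgefound`, Track 2 foundations, Layer A3; seat `lit-hodgefound-p11`, generation 27, row g27-#4).  Sequel of
`CMTypeSpecialElementReflexField` (g25-#6) and `CMTypeSignatureGaloisClasses` (g26-#2), which prove Howard's
«`K_Φ = φ^{sp}(K)`» — the reflex field of a CM type with a SPECIAL ELEMENT `σ₀` (signature `(1, n−1)` over an
IMAGINARY QUADRATIC `k₀`) is `σ₀(K) ≅ K` — for `k₀` quadratic.  Here `k₀ ≤ K` is a subfield of ANY degree and the
signature of `Φ` over `k₀` is the one of the simple Shimura varieties of Harris–Taylor and of the unitary Shimura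
varieties of Rapoport–Smithling–Zhang: multiplicity `1` above one embedding `φ₀`, hence `n − 1` above `φ̄₀`
(`n = [K : k₀]`), and BANAL (`0` or `n`) above every other embedding of `k₀`.  In the COMPLEX MODEL (`Φ : CMType K`,
`Aut(ℂ)` acting on `Hom(K, ℂ)`, reflex field `traceField Φ = K* = ℚ(tr_Φ(K)) ⊆ ℂ`).  THEOREMS ONLY (D-0026).

THE PRINT.  B. Howard, *Complex multiplication cycles and Kudla–Rapoport divisors*, Ann. of Math. 176 (2012)
[Howard2012] §3.1 (held `paper:arxiv-1303.0545` p. 19): «there is a unique `φ^{sp} ∈ Φ` whose restriction to `K₀` is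
`ῑ` […] `K_Φ = φ^{sp}(K)`» (`K₀` imaginary quadratic).  M. Harris, R. Taylor, *The Geometry and Cohomology of Some
Simple Shimura Varieties* (2001) [HarrisTaylor2001], Introduction p. 2 (held chunk p0010 L24): «`G₁(ℝ) ≅ U(1, n−1) ×
U(0, n)^{[F⁺:ℚ]−1}`», §I.7 (chunk p0049 L27): «invariants `(1, n − 1)` at `τ` and `(0, n)` at any `τ'` with
`τ ≠ τ'`».  M. Rapoport, B. Smithling, W. Zhang, *Arithmetic diagonal cycles on unitary Shimura varieties* (Compositio
2020) [RapoportSmithlingZhang2017] §3.2 (chunk p0011 L29): «the Kottwitz condition of signature `((1, n−1)_{φ₀},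
(0, n)_{φ ∈ Φ ∖ {φ₀}})`», §4.1 (chunk p0014 L71): «banal signature type … each integer `r_φ` … is equal to `0` or
`n`»; §3.1: the reflex field `E` of `(G̃, h_{G̃})` contains `φ₀(F)`.  G. Shimura (1998) [Shimura1998] §8.3 Prop. 28:
`K* = ℚ(tr_Φ)` and «`γS = S` iff `γ` fixes `K*`» (the tree's `forall_smul_mem_iff_iff_forall_apply_traceField_eq`).
J. Milne, *Fields and Galois Theory* (2022) [MilneFT2022] Thm. 3.9/Cor. 3.10 (normal extensions: every embedding has
the same image).

WHAT IS PROVED (`k₀ : IntermediateField ℚ K` arbitrary, `n = finrank k₀ K`; the multiplicity of `ψ : k₀ → ℂ` is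
`{φ | φ ∈ Φ.1 ∧ φ.comp (algebraMap k₀ K) = ψ}.ncard` as in `CMTypeSignatureGaloisClasses`; the HARRIS–TAYLOR
HYPOTHESES `h1 : m_{φ₀} = 1` and `hban : m_ψ ∈ {0, n}` for `ψ ∉ {φ₀, φ̄₀}`):

§1 `ncard_inter_fibre_conjugate_eq_of_harrisTaylor` (`m_{φ̄₀} = n − 1`), `eq_of_ncard_inter_fibre_eq_one_of_harrisTaylor`
   (`n ≥ 3`: `φ₀` is THE embedding of multiplicity one), `mem_of_comp_eq_of_ncard_inter_fibre_eq_finrank` (a banal full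
   fibre lies in `Φ`, any `Φ`), `mem_of_comp_eq_conjugate_of_ne_of_harrisTaylor` (the fibre above `φ̄₀` is
   `F_{φ̄₀} ∖ {σ̄₀}`), the special element being `ncard_inter_fibre_eq_one_iff_exists_special` of the tree.
§2 (`K` CM, `n ≥ 3`) **`smul_eq_of_forall_smul_mem_iff_of_harrisTaylor`** (`τΦ = Φ ⟹ τφ₀ = φ₀`: the signature is a
   stabiliser invariant, `ncard_inter_fibre_cmTypeSmul`) and **`smul_special_eq_of_forall_smul_mem_iff_of_harrisTaylor`**
   (`⟹ τσ₀ = σ₀`: Howard's «`τ` fixes `φ^{sp}`» beyond the quadratic case).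
§3 (`K` CM, `n ≥ 3`) **`fieldRange_le_traceField_of_harrisTaylor`: `σ₀(K) ⊆ K*`** — the reflex field of such a type
   contains a copy of `K`; `finrank_le_finrank_traceField_of_harrisTaylor` (`[K : ℚ] ≤ [K* : ℚ]`).
§4 the converse inclusion under `hfix : ∀ τ ψ, τφ₀ = φ₀ → τψ = ψ` («`Aut(ℂ/φ₀(k₀))` fixes `Hom(k₀, ℂ)`», automatic for
   `k₀/ℚ` normal: `smul_eq_of_smul_eq_of_normal`): **`forall_smul_mem_iff_of_smul_special_eq_of_harrisTaylor`**
   (`τσ₀ = σ₀ ⟹ τΦ = Φ`), `traceField_le_fieldRange_of_harrisTaylor` (`K* ⊆ σ₀(K)`), and for `n ≥ 3`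
   **`traceField_eq_fieldRange_of_harrisTaylor`: `K* = σ₀(K)`**, `finrank_traceField_eq_finrank_of_harrisTaylor`
   (`[K* : ℚ] = [K : ℚ]`), `nonempty_ringEquiv_traceField_of_harrisTaylor` (`K* ≅ K`);
   `traceField_eq_fieldRange_of_harrisTaylor_of_normal` (`k₀/ℚ` normal).

## References

* [Howard2012] B. Howard, *Complex multiplication cycles and Kudla–Rapoport divisors*, Ann. of Math. (2) 176 (2012),
  §3.1.
* [HarrisTaylor2001] M. Harris, R. Taylor, *The Geometry and Cohomology of Some Simple Shimura Varieties*, Ann. of Math.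
  Studies 151 (2001), Introduction p. 2, §I.7, Lemma III.1.2.
* [RapoportSmithlingZhang2017] M. Rapoport, B. Smithling, W. Zhang, *Arithmetic diagonal cycles on unitary Shimura
  varieties*, Compositio Math. 156 (2020), §3.1–3.2, §4.1.
* [Shimura1998] G. Shimura, *Abelian Varieties with Complex Multiplication and Modular Functions* (1998), §8.3 Prop. 28.
* [MilneFT2022] J. S. Milne, *Fields and Galois Theory* (2022), Thm. 3.9 / Cor. 3.10 (normal extensions), Prop. 2.7.
* [Dodson1984] B. Dodson, Trans. AMS 283 (1984), §3.1.1 (proof, p. 12).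

## Provenance

Lane `lit-hodgefound` (HOME `run/shared/lean/pub/lit-hodgefound/`), prover seat `lit-hodgefound-p11` (gen 27),
self-proposed row g27-#4 (INBOX claim 2026-08-27); field-level companion of the pair files
`AlgebraicGeometry/ComplexMultiplication/EndomorphismFieldSubfieldSignature{,ReflexField}` (g27-#1/#2).
-/

set_option autoImplicit false

noncomputable section

open scoped Classical NumberField Pointwise
open NumberField Module IntermediateField

namespace Literature.NumberTheory.ComplexMultiplication

open Literature.AlgebraicGeometry.Motives (CMType)
open Literature.AlgebraicGeometry.Motives.HodgeStructure (cmTypeSmul cmTypeSmul_val)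

variable {K : Type} [Field K] [NumberField K] (k₀ : IntermediateField ℚ K)

/-! ## §0 Preliminaries -/

section Prelim

/-- `(τφ)|_{k₀} = τ(φ|_{k₀})`. [folklore] -/
private theorem smul_comp_ht (τ : ℂ ≃+* ℂ) (φ : K →+* ℂ) :
    (τ • φ).comp (algebraMap k₀ K) = τ • φ.comp (algebraMap k₀ K) :=
  RingHom.ext fun _ => rfl

/-- `φ̄|_{k₀} = \overline{φ|_{k₀}}`. [folklore] -/
private theorem conjugate_comp_ht (φ : K →+* ℂ) :
    (ComplexEmbedding.conjugate φ).comp (algebraMap k₀ K) = ComplexEmbedding.conjugate (φ.comp (algebraMap k₀ K)) :=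
  (conjugate_comp_ringHom (algebraMap k₀ K) φ).symm

/-- The image of an embedding of a number field is finite over `ℚ`. [folklore] -/
private theorem finiteDimensional_fieldRange_ht {E : Type} [Field E] [NumberField E] (s : E →+* ℂ) :
    FiniteDimensional ℚ s.toRatAlgHom.fieldRange :=
  LinearEquiv.finiteDimensional (AlgEquiv.ofInjectiveField s.toRatAlgHom).toLinearEquiv

/-- `[s(E) : ℚ] = [E : ℚ]`. [folklore] -/
private theorem finrank_fieldRange_ht {E : Type} [Field E] [NumberField E] (s : E →+* ℂ) :
    finrank ℚ s.toRatAlgHom.fieldRange = finrank ℚ E := by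
  rw [← IntermediateField.finrank_eq_finrank_subalgebra, AlgHom.fieldRange_toSubalgebra]
  exact (AlgEquiv.ofInjectiveField s.toRatAlgHom).toLinearEquiv.finrank_eq.symm

/-- An embedding `s : E → ℂ` corestricted to a subfield EQUAL to its image is an isomorphism. [folklore] -/
private theorem nonempty_ringEquiv_of_eq_fieldRange_ht {E : Type} [Field E] [NumberField E]
    {M : IntermediateField ℚ ℂ} (s : E →+* ℂ) (hM : M = s.toRatAlgHom.fieldRange) : Nonempty (E ≃+* M) := by
  have hmem : ∀ y : E, s y ∈ M := fun y => by rw [hM]; exact ⟨y, rfl⟩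
  let g : E →+* M := s.codRestrict M hmem
  refine ⟨RingEquiv.ofBijective g ⟨g.injective, fun z => ?_⟩⟩
  have hz : (z : ℂ) ∈ s.toRatAlgHom.fieldRange := by rw [← hM]; exact z.2
  obtain ⟨y, hy⟩ := AlgHom.mem_fieldRange.1 hz
  exact ⟨y, Subtype.ext hy⟩

/-- `K* = ℚ(tr_Φ(K))` is a finite extension of `ℚ`. [folklore] -/
private theorem finiteDimensional_traceField_ht (Φ : CMType K) : FiniteDimensional ℚ (traceField Φ) :=
  Module.finite_of_finrank_pos (finrank_traceField_pos Φ)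

end Prelim

/-! ## §1 The Harris–Taylor / RSZ signature `((1, n−1)_{φ₀}, (0, n)_{ψ ∉ {φ₀, φ̄₀}})` over a subfield `k₀` -/

/-- **A BANAL FULL FIBRE LIES IN `Φ`**: if `m_ψ = #{φ ∈ Φ ∣ φ|_{k₀} = ψ} = [K : k₀] = #F_ψ` then every embedding of `K`
above `ψ` belongs to `Φ` (any CM type, any subfield). [cite: RapoportSmithlingZhang2017, §4.1 («banal»)]
[cite: MilneFT2022, Prop. 2.7 (a) (`#F_ψ = [K : k₀]`)] -/
theorem mem_of_comp_eq_of_ncard_inter_fibre_eq_finrank (Φ : CMType K) {ψ : k₀ →+* ℂ}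
    (hψ : {φ : K →+* ℂ | φ ∈ Φ.1 ∧ φ.comp (algebraMap k₀ K) = ψ}.ncard = finrank k₀ K)
    {φ : K →+* ℂ} (hφ : φ.comp (algebraMap k₀ K) = ψ) : φ ∈ Φ.1 := by
  have hsub : {φ : K →+* ℂ | φ ∈ Φ.1 ∧ φ.comp (algebraMap k₀ K) = ψ} ⊆
      {φ : K →+* ℂ | φ.comp (algebraMap k₀ K) = ψ} := fun φ h => h.2
  have heq := Set.eq_of_subset_of_ncard_le hsub (le_of_eq (by rw [ncard_fibre_eq_finrank k₀ ψ, hψ]))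
  have hmem : φ ∈ {φ : K →+* ℂ | φ.comp (algebraMap k₀ K) = ψ} := hφ
  rw [← heq] at hmem
  exact hmem.1

section HarrisTaylor

variable {Φ : CMType K} {φ₀ : k₀ →+* ℂ}
  (h1 : {φ : K →+* ℂ | φ ∈ Φ.1 ∧ φ.comp (algebraMap k₀ K) = φ₀}.ncard = 1)
  (hban : ∀ ψ : k₀ →+* ℂ, ψ ≠ φ₀ → ψ ≠ ComplexEmbedding.conjugate φ₀ →
    {φ : K →+* ℂ | φ ∈ Φ.1 ∧ φ.comp (algebraMap k₀ K) = ψ}.ncard = 0 ∨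
      {φ : K →+* ℂ | φ ∈ Φ.1 ∧ φ.comp (algebraMap k₀ K) = ψ}.ncard = finrank k₀ K)

include h1 in
/-- **Signature `((1, n−1)_{φ₀}, …)`: `m_{φ̄₀} = n − 1`** (`m_{φ₀} + m_{φ̄₀} = n`). [cite: RapoportSmithlingZhang2017, §3.2]
[cite: HarrisTaylor2001, §I.7] -/
theorem ncard_inter_fibre_conjugate_eq_of_harrisTaylor :
    {φ : K →+* ℂ | φ ∈ Φ.1 ∧ φ.comp (algebraMap k₀ K) = ComplexEmbedding.conjugate φ₀}.ncard = finrank k₀ K - 1 := by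
  have h := ncard_inter_fibre_add_ncard_inter_fibre_conjugate k₀ Φ φ₀
  omega

include h1 hban in
/-- **For `n = [K : k₀] ≥ 3`, `φ₀` is THE embedding of `k₀` of multiplicity one** (the others have multiplicity
`n − 1 ≥ 2`, `0` or `n`). [cite: RapoportSmithlingZhang2017, §3.2 and §4.1] -/
theorem eq_of_ncard_inter_fibre_eq_one_of_harrisTaylor (h3 : 3 ≤ finrank k₀ K) (χ : k₀ →+* ℂ)
    (hχ : {φ : K →+* ℂ | φ ∈ Φ.1 ∧ φ.comp (algebraMap k₀ K) = χ}.ncard = 1) : χ = φ₀ := by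
  by_contra hne
  by_cases hc : χ = ComplexEmbedding.conjugate φ₀
  · subst hc
    rw [ncard_inter_fibre_conjugate_eq_of_harrisTaylor k₀ h1] at hχ
    omega
  · have h := hban χ hne hc
    rw [hχ] at h
    omega

include h1 in
/-- **The fibre of `Φ` above `φ̄₀` is `F_{φ̄₀} ∖ {σ̄₀}`**, `σ₀` the special element above `φ₀`: every embedding above
`φ̄₀` other than `σ̄₀` lies in `Φ` (count: `m_{φ̄₀} = n − 1 = #F_{φ̄₀} − 1`, and `σ̄₀ ∉ Φ`). [cite: Howard2012, §3.1]
[cite: RapoportSmithlingZhang2017, §3.2] -/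
theorem mem_of_comp_eq_conjugate_of_ne_of_harrisTaylor {σ₀ : K →+* ℂ} (hσ₀ : σ₀ ∈ Φ.1)
    (hσ₀ψ : σ₀.comp (algebraMap k₀ K) = φ₀) {φ : K →+* ℂ}
    (hφ : φ.comp (algebraMap k₀ K) = ComplexEmbedding.conjugate φ₀) (hne : φ ≠ ComplexEmbedding.conjugate σ₀) :
    φ ∈ Φ.1 := by
  have hσbar : ComplexEmbedding.conjugate σ₀ ∉ Φ.1 := (Φ.2 σ₀).1 hσ₀
  have hσbar_res : (ComplexEmbedding.conjugate σ₀).comp (algebraMap k₀ K) = ComplexEmbedding.conjugate φ₀ := by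
    rw [conjugate_comp_ht, hσ₀ψ]
  have hsub : {φ : K →+* ℂ | φ ∈ Φ.1 ∧ φ.comp (algebraMap k₀ K) = ComplexEmbedding.conjugate φ₀} ⊆
      {φ : K →+* ℂ | φ.comp (algebraMap k₀ K) = ComplexEmbedding.conjugate φ₀} \ {ComplexEmbedding.conjugate σ₀} := by
    intro χ hχ
    refine ⟨hχ.2, fun h => hσbar ?_⟩
    rw [Set.mem_singleton_iff] at h
    rw [← h]
    exact hχ.1
  have hcard : ({φ : K →+* ℂ | φ.comp (algebraMap k₀ K) = ComplexEmbedding.conjugate φ₀} \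
      {ComplexEmbedding.conjugate σ₀}).ncard = finrank k₀ K - 1 := by
    rw [Set.ncard_sdiff_singleton_of_mem
      (show ComplexEmbedding.conjugate σ₀ ∈ {φ : K →+* ℂ |
        φ.comp (algebraMap k₀ K) = ComplexEmbedding.conjugate φ₀} from hσbar_res),
      ncard_fibre_eq_finrank k₀]
  have heq := Set.eq_of_subset_of_ncard_le hsub (le_of_eq (by
    rw [hcard, ncard_inter_fibre_conjugate_eq_of_harrisTaylor k₀ h1]))
  have hmem : φ ∈ {φ : K →+* ℂ | φ.comp (algebraMap k₀ K) = ComplexEmbedding.conjugate φ₀} \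
      {ComplexEmbedding.conjugate σ₀} := ⟨hφ, fun h => hne (Set.mem_singleton_iff.1 h)⟩
  rw [← heq] at hmem
  exact hmem.1

include hban in
/-- **A member of `Φ` above `ψ ∉ {φ₀, φ̄₀}` fills its fibre**: `m_ψ ≠ 0` forces `m_ψ = n`, so all of `F_ψ` lies in
`Φ`. [cite: RapoportSmithlingZhang2017, §4.1] -/
theorem mem_of_comp_eq_comp_of_mem_of_harrisTaylor {χ : K →+* ℂ} (hχ : χ ∈ Φ.1)
    (hχ0 : χ.comp (algebraMap k₀ K) ≠ φ₀) (hχ1 : χ.comp (algebraMap k₀ K) ≠ ComplexEmbedding.conjugate φ₀)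
    {φ : K →+* ℂ} (hφ : φ.comp (algebraMap k₀ K) = χ.comp (algebraMap k₀ K)) : φ ∈ Φ.1 := by
  rcases hban _ hχ0 hχ1 with h0 | h0
  · exfalso
    rw [Set.ncard_eq_zero] at h0
    exact (Set.eq_empty_iff_forall_notMem.1 h0) χ ⟨hχ, rfl⟩
  · exact mem_of_comp_eq_of_ncard_inter_fibre_eq_finrank k₀ Φ h0 hφ

/-! ## §2 The stabiliser of `Φ` fixes `φ₀` and the special element (`n ≥ 3`) -/

variable [IsCMField K]

include h1 hban in
/-- **`τΦ = Φ ⟹ τφ₀ = φ₀`** (`n ≥ 3`): the signature of `τΦ = Φ` over `k₀` at `τψ` is that of `Φ` at `ψ`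
(`ncard_inter_fibre_cmTypeSmul`), and `φ₀` is the only embedding of multiplicity one.
[cite: Howard2012, §3.1] [cite: Shimura1998, §8.3 Prop. 28] [cite: Dodson1984, §3.1.1 Theorem (proof)] -/
theorem smul_eq_of_forall_smul_mem_iff_of_harrisTaylor (h3 : 3 ≤ finrank k₀ K) {τ : ℂ ≃+* ℂ}
    (hτ : ∀ χ : K →+* ℂ, τ • χ ∈ Φ.1 ↔ χ ∈ Φ.1) : τ • φ₀ = φ₀ := by
  have hfix : cmTypeSmul τ Φ = Φ := by
    refine Subtype.ext (Set.ext fun χ => ?_)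
    rw [cmTypeSmul_val, Set.mem_smul_set_iff_inv_smul_mem, ← hτ (τ⁻¹ • χ), smul_inv_smul]
  have h := ncard_inter_fibre_cmTypeSmul k₀ τ Φ (τ • φ₀)
  rw [hfix, inv_smul_smul, h1] at h
  exact eq_of_ncard_inter_fibre_eq_one_of_harrisTaylor k₀ h1 hban h3 _ h

include h1 hban in
/-- **`τΦ = Φ ⟹ τσ₀ = σ₀`** for the special element `σ₀ ∈ Φ` above `φ₀` (`n ≥ 3`): `τσ₀ ∈ τΦ = Φ` lies above
`τφ₀ = φ₀`. (Howard, `k₀` quadratic: the automorphisms fixing `Φ` are those fixing `φ^{sp}(K)`.)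
[cite: Howard2012, §3.1] [cite: Shimura1998, §8.3 Prop. 28] -/
theorem smul_special_eq_of_forall_smul_mem_iff_of_harrisTaylor (h3 : 3 ≤ finrank k₀ K) {σ₀ : K →+* ℂ}
    (hσ₀ : σ₀ ∈ Φ.1) (hσ₀ψ : σ₀.comp (algebraMap k₀ K) = φ₀) {τ : ℂ ≃+* ℂ}
    (hτ : ∀ χ : K →+* ℂ, τ • χ ∈ Φ.1 ↔ χ ∈ Φ.1) : τ • σ₀ = σ₀ := by
  obtain ⟨σ₁, hσ₁, hσ₁ψ, huniq⟩ := (ncard_inter_fibre_eq_one_iff_exists_special k₀ Φ φ₀).1 h1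
  have hσ₀₁ : σ₀ = σ₁ := huniq σ₀ hσ₀ (hσ₀ψ.trans hσ₁ψ.symm)
  have hτφ₀ := smul_eq_of_forall_smul_mem_iff_of_harrisTaylor k₀ h1 hban h3 hτ
  refine (huniq (τ • σ₀) ((hτ σ₀).2 hσ₀) ?_).trans hσ₀₁.symm
  rw [smul_comp_ht, hσ₀ψ, hτφ₀, hσ₁ψ]

/-! ## §3 `σ₀(K) ⊆ K*` (`n ≥ 3`) -/

include h1 hban in
/-- **THE REFLEX FIELD CONTAINS `σ₀(K)`** for a CM type with the Harris–Taylor / RSZ signature over `k₀`, `n ≥ 3`: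
an automorphism of `ℂ` fixing `K* = ℚ(tr_Φ)` fixes `Φ` (Shimura §8.3 Prop. 28), hence `φ₀`, hence the special
element `σ₀`, i.e. fixes `σ₀(K)` pointwise; by the Galois correspondence for `Aut(ℂ)` (the tree's
`exists_ringEquiv_apply_ne_of_not_mem`) `σ₀(K) ⊆ K*`.  Howard's «`K_Φ ⊇ φ^{sp}(K)`», for a CM subfield `k₀` of any
degree. [cite: Howard2012, §3.1] [cite: RapoportSmithlingZhang2017, §3.1–3.2] [cite: Shimura1998, §8.3 Prop. 28] -/
theorem fieldRange_le_traceField_of_harrisTaylor (h3 : 3 ≤ finrank k₀ K) {σ₀ : K →+* ℂ} (hσ₀ : σ₀ ∈ Φ.1)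
    (hσ₀ψ : σ₀.comp (algebraMap k₀ K) = φ₀) : σ₀.toRatAlgHom.fieldRange ≤ traceField Φ := by
  haveI := finiteDimensional_fieldRange_ht σ₀
  haveI := finiteDimensional_traceField_ht Φ
  intro z hz
  by_contra hzM
  obtain ⟨τ, hτM, hτz⟩ := exists_ringEquiv_apply_ne_of_not_mem (M := traceField Φ) (N := σ₀.toRatAlgHom.fieldRange)
    hz hzM
  have hτσ := smul_special_eq_of_forall_smul_mem_iff_of_harrisTaylor k₀ h1 hban h3 hσ₀ hσ₀ψ
    ((forall_smul_mem_iff_iff_forall_apply_traceField_eq τ Φ).2 hτM)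
  obtain ⟨x, rfl⟩ := AlgHom.mem_fieldRange.1 hz
  apply hτz
  change τ (σ₀ x) = σ₀ x
  rw [← ringEquiv_smul_apply τ σ₀ x, hτσ]

include h1 hban in
/-- Hence **`[K : ℚ] ≤ [K* : ℚ]`**: the reflex field of a type with the Harris–Taylor signature (`n ≥ 3`) has degree
at least `[K : ℚ]`. [cite: Howard2012, §3.1] [cite: RapoportSmithlingZhang2017, §3.1–3.2] -/
theorem finrank_le_finrank_traceField_of_harrisTaylor (h3 : 3 ≤ finrank k₀ K) :
    finrank ℚ K ≤ finrank ℚ (traceField Φ) := by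
  haveI := finiteDimensional_traceField_ht Φ
  obtain ⟨σ₀, hσ₀, hσ₀ψ, -⟩ := (ncard_inter_fibre_eq_one_iff_exists_special k₀ Φ φ₀).1 h1
  rw [← finrank_fieldRange_ht σ₀]
  exact IntermediateField.finrank_le_of_le_right (fieldRange_le_traceField_of_harrisTaylor k₀ h1 hban h3 hσ₀ hσ₀ψ)

/-! ## §4 `K* = σ₀(K)` when `Aut(ℂ/φ₀(k₀))` fixes every embedding of `k₀` -/

include h1 hban in
/-- **`τσ₀ = σ₀ ⟹ τΦ = Φ`, provided `τ` fixes every embedding of `k₀`** (which it does as soon as it fixes `φ₀` and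
`k₀/ℚ` is normal, §4 below): `τ` then permutes each fibre `F_ψ`; the fibre of `Φ` above `φ₀` is `{σ₀}` (fixed), a
banal fibre is empty or all of `F_ψ`, and the fibre above `φ̄₀` is `F_{φ̄₀} ∖ {σ̄₀}`, whose image avoids `σ̄₀`
because `τΦ` is a CM type containing `τσ₀ = σ₀`.  So `τΦ ⊆ Φ`, and equality by counting.
[cite: Howard2012, §3.1] [cite: Shimura1998, §8.3 Prop. 28] -/
theorem forall_smul_mem_iff_of_smul_special_eq_of_harrisTaylor {σ₀ : K →+* ℂ} (hσ₀ : σ₀ ∈ Φ.1)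
    (hσ₀ψ : σ₀.comp (algebraMap k₀ K) = φ₀) {τ : ℂ ≃+* ℂ} (hfix : ∀ ψ : k₀ →+* ℂ, τ • ψ = ψ)
    (hτσ : τ • σ₀ = σ₀) : ∀ χ : K →+* ℂ, τ • χ ∈ Φ.1 ↔ χ ∈ Φ.1 := by
  obtain ⟨σ₁, hσ₁, hσ₁ψ, huniq⟩ := (ncard_inter_fibre_eq_one_iff_exists_special k₀ Φ φ₀).1 h1
  have hσ₀₁ : σ₀ = σ₁ := huniq σ₀ hσ₀ (hσ₀ψ.trans hσ₁ψ.symm)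
  -- `τΦ ⊆ Φ`
  have hsub : τ • Φ.1 ⊆ Φ.1 := by
    rintro _ ⟨φ, hφ, rfl⟩
    change τ • φ ∈ Φ.1
    have hres : (τ • φ).comp (algebraMap k₀ K) = φ.comp (algebraMap k₀ K) := by
      rw [smul_comp_ht, hfix]
    by_cases hψ0 : φ.comp (algebraMap k₀ K) = φ₀
    · -- `φ = σ₀`
      have hφσ : φ = σ₀ := (huniq φ hφ (hψ0.trans hσ₁ψ.symm)).trans hσ₀₁.symm
      rw [hφσ, hτσ]
      exact hσ₀
    by_cases hψ1 : φ.comp (algebraMap k₀ K) = ComplexEmbedding.conjugate φ₀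
    · -- above `φ̄₀`: `τφ ≠ σ̄₀` since `τΦ` is a CM type containing `σ₀ = τσ₀`
      refine mem_of_comp_eq_conjugate_of_ne_of_harrisTaylor k₀ h1 hσ₀ hσ₀ψ (hres.trans hψ1) fun h => ?_
      have hmem : τ • φ ∈ (cmTypeSmul τ Φ).1 := by
        rw [cmTypeSmul_val]
        exact Set.smul_mem_smul_set hφ
      have hσmem : σ₀ ∈ (cmTypeSmul τ Φ).1 := by
        rw [cmTypeSmul_val, ← hτσ]
        exact Set.smul_mem_smul_set hσ₀
      rw [h] at hmem
      exact ((cmTypeSmul τ Φ).2 σ₀).1 hσmem hmem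
    · exact mem_of_comp_eq_comp_of_mem_of_harrisTaylor k₀ hban hφ hψ0 hψ1 hres
  -- equality by counting
  have heq : τ • Φ.1 = Φ.1 :=
    Set.eq_of_subset_of_ncard_le hsub (le_of_eq (Set.ncard_image_of_injective _ (MulAction.injective τ)).symm)
  intro χ
  constructor
  · intro h
    rw [← heq] at h
    exact Set.smul_mem_smul_set_iff.1 h
  · intro h
    rw [← heq]
    exact Set.smul_mem_smul_set h

include h1 hban in
/-- **`K* ⊆ σ₀(K)` when `Aut(ℂ/φ₀(k₀))` fixes every embedding of `k₀`**: an automorphism of `ℂ` fixing `σ₀(K)` fixes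
`σ₀`, hence `φ₀ = σ₀|_{k₀}`, hence (hypothesis) every embedding of `k₀`, hence `Φ` (previous theorem), hence `K*`
(Shimura §8.3 Prop. 28). [cite: Howard2012, §3.1] [cite: Shimura1998, §8.3 Prop. 28] -/
theorem traceField_le_fieldRange_of_harrisTaylor {σ₀ : K →+* ℂ} (hσ₀ : σ₀ ∈ Φ.1)
    (hσ₀ψ : σ₀.comp (algebraMap k₀ K) = φ₀)
    (hfix : ∀ (τ : ℂ ≃+* ℂ) (ψ : k₀ →+* ℂ), τ • φ₀ = φ₀ → τ • ψ = ψ) :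
    traceField Φ ≤ σ₀.toRatAlgHom.fieldRange := by
  haveI := finiteDimensional_fieldRange_ht σ₀
  haveI := finiteDimensional_traceField_ht Φ
  intro z hz
  by_contra hzM
  obtain ⟨τ, hτM, hτz⟩ := exists_ringEquiv_apply_ne_of_not_mem (M := σ₀.toRatAlgHom.fieldRange)
    (N := traceField Φ) hz hzM
  have hτσ : τ • σ₀ = σ₀ := RingHom.ext fun x => by
    rw [ringEquiv_smul_apply]
    exact hτM _ (AlgHom.mem_fieldRange.2 ⟨x, rfl⟩)
  have hτφ₀ : τ • φ₀ = φ₀ := by rw [← hσ₀ψ, ← smul_comp_ht, hτσ]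
  exact hτz ((forall_smul_mem_iff_iff_forall_apply_traceField_eq τ Φ).1
    (forall_smul_mem_iff_of_smul_special_eq_of_harrisTaylor k₀ h1 hban hσ₀ hσ₀ψ (hfix τ · hτφ₀) hτσ) z hz)

include h1 hban in
/-- **`K* = σ₀(K)`** for a CM type with the Harris–Taylor / RSZ signature over `k₀`, `n = [K : k₀] ≥ 3`, whenever
`Aut(ℂ/φ₀(k₀))` fixes every embedding of `k₀` (e.g. `k₀/ℚ` normal) — Howard's «`K_Φ = φ^{sp}(K)`» (`k₀` imaginary
quadratic, the tree's `traceField_eq_fieldRange_of_special`) for a subfield of any degree.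
[cite: Howard2012, §3.1] [cite: RapoportSmithlingZhang2017, §3.1–3.2] [cite: Shimura1998, §8.3 Prop. 28] -/
theorem traceField_eq_fieldRange_of_harrisTaylor (h3 : 3 ≤ finrank k₀ K) {σ₀ : K →+* ℂ} (hσ₀ : σ₀ ∈ Φ.1)
    (hσ₀ψ : σ₀.comp (algebraMap k₀ K) = φ₀)
    (hfix : ∀ (τ : ℂ ≃+* ℂ) (ψ : k₀ →+* ℂ), τ • φ₀ = φ₀ → τ • ψ = ψ) :
    traceField Φ = σ₀.toRatAlgHom.fieldRange :=
  le_antisymm (traceField_le_fieldRange_of_harrisTaylor k₀ h1 hban hσ₀ hσ₀ψ hfix)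
    (fieldRange_le_traceField_of_harrisTaylor k₀ h1 hban h3 hσ₀ hσ₀ψ)

include h1 hban in
/-- **`[K* : ℚ] = [K : ℚ]`** under the same hypotheses. [cite: Howard2012, §3.1] -/
theorem finrank_traceField_eq_finrank_of_harrisTaylor (h3 : 3 ≤ finrank k₀ K)
    (hfix : ∀ (τ : ℂ ≃+* ℂ) (ψ : k₀ →+* ℂ), τ • φ₀ = φ₀ → τ • ψ = ψ) :
    finrank ℚ (traceField Φ) = finrank ℚ K := by
  obtain ⟨σ₀, hσ₀, hσ₀ψ, -⟩ := (ncard_inter_fibre_eq_one_iff_exists_special k₀ Φ φ₀).1 h1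
  rw [traceField_eq_fieldRange_of_harrisTaylor k₀ h1 hban h3 hσ₀ hσ₀ψ hfix, finrank_fieldRange_ht]

include h1 hban in
/-- **`K* ≅ K`** under the same hypotheses. [cite: Howard2012, §3.1] -/
theorem nonempty_ringEquiv_traceField_of_harrisTaylor (h3 : 3 ≤ finrank k₀ K)
    (hfix : ∀ (τ : ℂ ≃+* ℂ) (ψ : k₀ →+* ℂ), τ • φ₀ = φ₀ → τ • ψ = ψ) :
    Nonempty (K ≃+* traceField Φ) := by
  obtain ⟨σ₀, hσ₀, hσ₀ψ, -⟩ := (ncard_inter_fibre_eq_one_iff_exists_special k₀ Φ φ₀).1 h1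
  exact nonempty_ringEquiv_of_eq_fieldRange_ht σ₀ (traceField_eq_fieldRange_of_harrisTaylor k₀ h1 hban h3 hσ₀ hσ₀ψ hfix)

end HarrisTaylor

/-! ## §5 `Aut(ℂ/φ₀(k₀))` fixes every embedding of a NORMAL `k₀/ℚ` -/

/-- **For `k₀/ℚ` normal, an automorphism of `ℂ` fixing one embedding `φ₀` of `k₀` fixes all of them**: every
`ψ(x)`, `x ∈ k₀`, is a complex root of the minimal polynomial of `x`, which splits in `k₀`, so `ψ(x) = φ₀(y)` for a
root `y ∈ k₀` (Mathlib `Polynomial.Splits.image_rootSet`). [cite: MilneFT2022, Thm. 3.9 and Cor. 3.10 (normal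
extensions)] -/
theorem smul_eq_of_smul_eq_of_normal [Normal ℚ k₀] {φ₀ : k₀ →+* ℂ} {τ : ℂ ≃+* ℂ} (hτ : τ • φ₀ = φ₀)
    (ψ : k₀ →+* ℂ) : τ • ψ = ψ := by
  refine RingHom.ext fun x => ?_
  rw [ringEquiv_smul_apply]
  have hint : IsIntegral ℚ x := Algebra.IsIntegral.isIntegral x
  have hsplit := Normal.splits (inferInstance : Normal ℚ k₀) x
  have hroot : ψ x ∈ (minpoly ℚ x).rootSet ℂ := by
    rw [Polynomial.mem_rootSet]
    refine ⟨minpoly.ne_zero hint, ?_⟩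
    have h := Polynomial.aeval_algHom_apply ψ.toRatAlgHom x (minpoly ℚ x)
    rw [minpoly.aeval, map_zero] at h
    exact h
  rw [← hsplit.image_rootSet φ₀.toRatAlgHom] at hroot
  obtain ⟨y, -, hy⟩ := hroot
  have hy' : φ₀ y = ψ x := hy
  rw [← hy', ← ringEquiv_smul_apply τ φ₀ y, hτ]

/-- **`K* = σ₀(K)` for a CM type with the Harris–Taylor / RSZ signature over a NORMAL subfield `k₀/ℚ`**, `n ≥ 3`
(e.g. `k₀` imaginary quadratic — Howard —, or any Galois CM field `k₀`). [cite: Howard2012, §3.1]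
[cite: RapoportSmithlingZhang2017, §3.1–3.2] [cite: MilneFT2022, Cor. 3.10] -/
theorem traceField_eq_fieldRange_of_harrisTaylor_of_normal [IsCMField K] [Normal ℚ k₀] {Φ : CMType K}
    {φ₀ : k₀ →+* ℂ} (h1 : {φ : K →+* ℂ | φ ∈ Φ.1 ∧ φ.comp (algebraMap k₀ K) = φ₀}.ncard = 1)
    (hban : ∀ ψ : k₀ →+* ℂ, ψ ≠ φ₀ → ψ ≠ ComplexEmbedding.conjugate φ₀ →
      {φ : K →+* ℂ | φ ∈ Φ.1 ∧ φ.comp (algebraMap k₀ K) = ψ}.ncard = 0 ∨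
        {φ : K →+* ℂ | φ ∈ Φ.1 ∧ φ.comp (algebraMap k₀ K) = ψ}.ncard = finrank k₀ K)
    (h3 : 3 ≤ finrank k₀ K) {σ₀ : K →+* ℂ} (hσ₀ : σ₀ ∈ Φ.1) (hσ₀ψ : σ₀.comp (algebraMap k₀ K) = φ₀) :
    traceField Φ = σ₀.toRatAlgHom.fieldRange :=
  traceField_eq_fieldRange_of_harrisTaylor k₀ h1 hban h3 hσ₀ hσ₀ψ fun _ ψ hτ => smul_eq_of_smul_eq_of_normal k₀ hτ ψ

end Literature.NumberTheory.ComplexMultiplication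

end
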